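import Summits.RiemannHypothesis.RiemannHypothesis.Theorems.IntegerScrewCensusFastSound

/-!
# Route `IntegerScrew` — fast kernel arithmetic for manifest-certificate checks (10): the checker's nodes

Between the pieces of `IntegerScrewCensusFastSound` and the assembly `IntegerScrewCensusFastSoundB`
(`manifestCert_of_fastCheckB`): the size caps of `fastLight` (`pos_le`: `POS ≤ 2^178`; `errUnit_le`: `E1 ≤ 2^167`;
`Uk_le_of_light`: `U_k ≤ 1/26`; log widths `≤ maxLogWidth`), list plumbing for the u-table rows and `sumN`, the integer
values of the fields of a packed node `packNodeB` (`xa_cast … lwc_cast`), and the per-pair / per-node bounds for the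
checker's ACTUAL packed nodes: `pair_le` (`2^164 |R_ij| ≤ pairAbs …`, from `pair_num`, `pair_bracket`, `pairAbs_ge`) and
`diag_ge` (`diagLoN ≤ 2^164 R_ii + 2·OZ + ZB`, from `numD_err`, `diagLoN_le`).  RH-free; nothing here bears on the truth of RH.
-/

set_option linter.dupNamespace false
set_option autoImplicit false

namespace Summit.RiemannHypothesis.RiemannHypothesis.Theorems.IntegerScrew.Manifest.Fast

open Finset
open Literature.Analysis.ValidatedNumerics Literature.Analysis.ValidatedNumerics.Numerics
open Literature.Analysis.ValidatedNumerics.KroneckerDot Literature.NumberTheory.LFunctions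

/-! ### Size caps -/

/-- `POS ≤ 2^178` under the caps of `fastLight` (`K ≤ 512` atoms, `Ω_k < 2^60`, `WJ < 2^60`). -/
theorem pos_le {K WJ : ℕ} {oms : List ℕ} (hKoms : oms.length = K) (ho : OmSmall oms) (hK2 : K ≤ 512)
    (hWJ : WJ < 2 ^ 60) : 2 ^ 104 * (sumN oms + WJ) + 2 * K * (D0 * D1) + 2 ^ 53 * K * D0 ≤ 2 ^ 178 := by
  have hSO : sumN oms ≤ 512 * 2 ^ 60 :=
    (sumN_le_of_le fun x hx => (ho x hx).le).trans (by rw [hKoms]; exact Nat.mul_le_mul_right _ hK2)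
  calc 2 ^ 104 * (sumN oms + WJ) + 2 * K * (D0 * D1) + 2 ^ 53 * K * D0
      ≤ 2 ^ 104 * (512 * 2 ^ 60 + 2 ^ 60) + 2 * 512 * (D0 * D1) + 2 ^ 53 * 512 * D0 :=
        Nat.add_le_add (Nat.add_le_add (Nat.mul_le_mul_left _ (Nat.add_le_add hSO hWJ.le))
          (Nat.mul_le_mul_right _ (Nat.mul_le_mul_left _ hK2))) (Nat.mul_le_mul_right _ (Nat.mul_le_mul_left _ hK2))
    _ ≤ 2 ^ 178 := by unfold D0 D1; norm_num

/-- `E1 ≤ 2^167` under the caps of `fastLight` (`j_k, Wmax ≤ 2^20`, `Ω_k < 2^60`, `K ≤ 512`). -/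
theorem errUnit_le {Wmax : ℕ} {js oms : List ℕ} (hWmax : Wmax ≤ 2 ^ 20) (hjs : ∀ j ∈ js, j ≤ 2 ^ 20)
    (ho : OmSmall oms) (hlen : js.length ≤ 512) : errUnit Wmax js oms ≤ 2 ^ 167 := by
  have hterm : ∀ x ∈ List.zipWith (fun j o => o * (32 * j * Wmax + 7000)) js oms,
      x ≤ 2 ^ 60 * (32 * 2 ^ 20 * 2 ^ 20 + 7000) := by
    intro x hx
    rw [List.mem_iff_getElem] at hx
    obtain ⟨k, hk, rfl⟩ := hx
    rw [List.getElem_zipWith]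
    rw [List.length_zipWith] at hk
    have hj := hjs _ (List.getElem_mem (l := js) (n := k) (by omega))
    have hoo := ho _ (List.getElem_mem (l := oms) (n := k) (by omega))
    exact Nat.mul_le_mul hoo.le (Nat.add_le_add_right (Nat.mul_le_mul (Nat.mul_le_mul_left _ hj) hWmax) _)
  have hsum := sumN_le_of_le hterm
  rw [List.length_zipWith] at hsum
  have hl : min js.length oms.length ≤ 512 := (Nat.min_le_left _ _).trans hlen
  have hs : sumN (List.zipWith (fun j o => o * (32 * j * Wmax + 7000)) js oms) ≤
      512 * (2 ^ 60 * (32 * 2 ^ 20 * 2 ^ 20 + 7000)) := hsum.trans (Nat.mul_le_mul_right _ hl)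
  show SCL * sumN (List.zipWith (fun j o => o * (32 * j * Wmax + 7000)) js oms) / 500 + 1 ≤ 2 ^ 167
  calc SCL * sumN (List.zipWith (fun j o => o * (32 * j * Wmax + 7000)) js oms) / 500 + 1
      ≤ SCL * (512 * (2 ^ 60 * (32 * 2 ^ 20 * 2 ^ 20 + 7000))) / 500 + 1 :=
        Nat.add_le_add_right (Nat.div_le_div_right (Nat.mul_le_mul_left _ hs)) 1
    _ ≤ 2 ^ 167 := by unfold SCL; norm_num

/-- The light test's inequality gives `U_k ≤ 1/26`. -/
theorem Uk_le_of_light {Wmax j : ℕ} (h : (32 * j * Wmax + 7000) * 26 ≤ SCL * 500) : Uk Wmax 500 j ≤ 1 / 26 := by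
  unfold Uk
  have h' : ((32 * j * Wmax + 7000) * 26 : ℝ) ≤ SCL * 500 := by exact_mod_cast h
  have hS : (0 : ℝ) < SCL := by norm_num [SCL]
  rw [div_le_div_iff₀ hS (by norm_num)]
  have e : (32 * (j : ℝ) * Wmax / ((500 : ℕ) : ℝ) + 14) * 26 = ((32 * j * Wmax + 7000) * 26 : ℝ) / 500 := by
    push_cast; ring
  rw [e, div_le_iff₀ (by norm_num)]
  linarith

/-- The widths of the log enclosures of the nodes `1 ≤ m ≤ N` are `≤ maxLogWidth logs N`. -/
theorem logLoW_le_maxLogWidth (logs : List FI) : ∀ {N m : ℕ}, m ≤ N → 1 ≤ m → (logLoW logs m).2 ≤ maxLogWidth logs N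
  | 0, _, h, h1 => by omega
  | N + 1, m, h, h1 => by
    show (logLoW logs m).2 ≤ max (maxLogWidth logs N) (logLoW logs (N + 1)).2
    rcases Nat.lt_or_ge m (N + 1) with hlt | hge
    · exact (logLoW_le_maxLogWidth logs (by omega) h1).trans (le_max_left _ _)
    · have hm : m = N + 1 := by omega
      subst hm
      exact le_max_right _ _

/-! ### List plumbing -/

/-- `getD` of `drop 2`. -/
theorem getD_drop_two {α : Type*} (l : List α) (i : ℕ) (d : α) : (l.drop 2).getD i d = l.getD (i + 2) d := by
  rw [List.getD_eq_getElem?_getD, List.getElem?_drop, ← List.getD_eq_getElem?_getD, Nat.add_comm]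

/-- Row `i < n` of `(utab.drop 2).take n` is row `i + 2` of `utab`. -/
theorem getD_urows {α : Type*} (utab : List (List α)) {n i : ℕ} (hi : i < n) :
    ((utab.drop 2).take n).getD i [] = utab.getD (i + 2) [] := by
  rw [List.getD_eq_getElem?_getD, List.getElem?_take_of_lt hi, ← List.getD_eq_getElem?_getD, getD_drop_two]

/-- `sumN l` as a sum over any range beyond the length. -/
theorem sumN_eq_sum_range {l : List ℕ} : ∀ {N : ℕ}, l.length ≤ N → sumN l = ∑ j ∈ range N, l.getD j 0 := by
  intro N hN
  induction N, hN using Nat.le_induction with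
  | base => exact sumN_eq_sum l
  | succ N hN ih => rw [Finset.sum_range_succ, ← ih, List.getD_eq_default _ _ hN, Nat.add_zero]

/-! ### The fields of a packed node as integers -/

/-- `xa = u₁ + NA + ZB − 4dE1` exactly (`4dE1 ≤ ZB`). -/
theorem xa_cast (E1 da : ℕ) (oms : List ℕ) (ra : List (ℕ × ℕ)) (ua : ℕ × ℕ) (hF : 4 * da * E1 ≤ ZB) :
    (((packNodeB E1 oms (da, ra) ua).xa : ℕ) : ℤ) =
      ua.1 + ((D1 * ((packNodeB E1 oms (da, ra) ua).lwc + (packNodeB E1 oms (da, ra) ua).lws) +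
        SCL * (packNodeB E1 oms (da, ra) ua).lwc : ℕ) : ℤ) + ZB - ((4 * da * E1 : ℕ) : ℤ) := by
  rw [packNodeB_eq]
  dsimp only
  have hle : 4 * da * E1 ≤ ua.1 + (D1 * ((packW oms ra).2.2.1 + (packW oms ra).2.2.2) + SCL * (packW oms ra).2.2.1) + ZB :=
    hF.trans (Nat.le_add_left _ _)
  rw [Nat.cast_sub hle]
  push_cast
  ring

/-- `xb = u₁ + NB + ZB − (4d+5)E1` exactly (`(4d+5)E1 ≤ ZB`). -/
theorem xb_cast (E1 db : ℕ) (oms : List ℕ) (rb : List (ℕ × ℕ)) (ub : ℕ × ℕ) (hF : (4 * db + 5) * E1 ≤ ZB) :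
    (((packNodeB E1 oms (db, rb) ub).xb : ℕ) : ℤ) =
      ub.1 + ((D0 * ((packNodeB E1 oms (db, rb) ub).mpc + (packNodeB E1 oms (db, rb) ub).mps) +
        SCL * (packNodeB E1 oms (db, rb) ub).lwc : ℕ) : ℤ) + ZB - (((4 * db + 5) * E1 : ℕ) : ℤ) := by
  rw [packNodeB_eq]
  dsimp only
  have hle : (4 * db + 5) * E1 ≤
      ub.1 + (D0 * ((packPB rb).2.2.1 + (packPB rb).2.2.2.1) + SCL * (packW oms rb).2.2.1) + ZB :=
    hF.trans (Nat.le_add_left _ _)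
  rw [Nat.cast_sub hle]
  push_cast
  ring

/-- `ya = u₂ + NA + 4dE1`. -/
theorem ya_cast (E1 da : ℕ) (oms : List ℕ) (ra : List (ℕ × ℕ)) (ua : ℕ × ℕ) :
    (((packNodeB E1 oms (da, ra) ua).ya : ℕ) : ℤ) =
      ua.2 + ((D1 * ((packNodeB E1 oms (da, ra) ua).lwc + (packNodeB E1 oms (da, ra) ua).lws) +
        SCL * (packNodeB E1 oms (da, ra) ua).lwc : ℕ) : ℤ) + ((4 * da * E1 : ℕ) : ℤ) := by
  rw [packNodeB_eq]
  dsimp only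
  push_cast
  ring

/-- `yb = u₂ + NB + (4d+5)E1`. -/
theorem yb_cast (E1 db : ℕ) (oms : List ℕ) (rb : List (ℕ × ℕ)) (ub : ℕ × ℕ) :
    (((packNodeB E1 oms (db, rb) ub).yb : ℕ) : ℤ) =
      ub.2 + ((D0 * ((packNodeB E1 oms (db, rb) ub).mpc + (packNodeB E1 oms (db, rb) ub).mps) +
        SCL * (packNodeB E1 oms (db, rb) ub).lwc : ℕ) : ℤ) + (((4 * db + 5) * E1 : ℕ) : ℤ) := by
  rw [packNodeB_eq]
  dsimp only
  push_cast
  ring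

/-- `lwc = L_c + K·D0` for a row in range. -/
theorem lwc_cast {E1 da K : ℕ} {oms : List ℕ} {ra : List (ℕ × ℕ)} (ua : ℕ × ℕ) (ho : OmSmall oms) (hr : RowSmall ra)
    (hK : oms.length = K) (hra : ra.length = K) :
    (((packNodeB E1 oms (da, ra) ua).lwc : ℕ) : ℤ) = Lc oms ra K + K * D0 := by
  rw [packNodeB_eq]
  dsimp only
  rw [packW_eq]
  exact sumN_dWc ho hr hK hra

/-! ### The per-pair and per-node bounds for the checker's packed nodes -/

/-- **Per pair** `a = i+2 > b = j+2`: `2^164 |R_ij| ≤ pairAbs …` for the packed nodes of the correct rows of `a` and `b`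
and the scaled digits of `u(a,1)`, `u(b,1)`, `u(a,b)`. -/
theorem pair_le {n K E1 Wmax WJ CL CH POS G1 G2 : ℕ} {js oms : List ℕ} {dra drb : ℕ × List (ℕ × ℕ)}
    {ua ub uab : ℕ × ℕ} (i j : Fin n) (hij : (j : ℕ) < i)
    (hPOS : POS = 2 ^ 104 * (sumN oms + WJ) + 2 * K * (D0 * D1) + 2 ^ 53 * K * D0) (hG1 : G1 = CL + 2 * ZB - POS)
    (hG2 : G2 = CH + 2 * ZB - POS) (hK1 : 1 ≤ K) (hK2 : K ≤ 512) (hKjs : js.length = K) (hKoms : oms.length = K) (ho : OmSmall oms)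
    (hpos : ∀ k, k < K → 0 < js.getD k 0) (hU : ∀ k, k < K → Uk Wmax 500 (js.getD k 0) ≤ 1 / 26)
    (hra : RowOK Wmax 500 js ((i : ℕ) + 2) dra) (hrb : RowOK Wmax 500 js ((j : ℕ) + 2) drb)
    (hE : 2 ^ 104 * ∑ k ∈ range K, (oms.getD k 0 : ℝ) * Uk Wmax 500 (js.getD k 0) ≤ E1) (hE1 : E1 ≤ 2 ^ 167)
    (hWJ : WJ < 2 ^ 60) (hCL : (CL : ℝ) ≤ 2 ^ 162 * RungCert.lerchC) (hCH : 2 ^ 162 * RungCert.lerchC ≤ CH)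
    (hua1 : (ua.1 : ℝ) ≤ 2 ^ 164 * RungCert.uR ((i : ℕ) + 2) 1 + OZ)
    (hua2 : 2 ^ 164 * RungCert.uR ((i : ℕ) + 2) 1 + OZ ≤ (ua.2 : ℝ))
    (hub1 : (ub.1 : ℝ) ≤ 2 ^ 164 * RungCert.uR ((j : ℕ) + 2) 1 + OZ)
    (hub2 : 2 ^ 164 * RungCert.uR ((j : ℕ) + 2) 1 + OZ ≤ (ub.2 : ℝ))
    (huab1 : (uab.1 : ℝ) ≤ 2 ^ 164 * RungCert.uR ((i : ℕ) + 2) ((j : ℕ) + 2) + OZ)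
    (huab2 : 2 ^ 164 * RungCert.uR ((i : ℕ) + 2) ((j : ℕ) + 2) + OZ ≤ (uab.2 : ℝ)) (huab3 : uab.2 < 2 ^ 174) :
    2 ^ 164 * |remainder n K (fun k : Fin K => (js.getD k 0 : ℝ) / 500)
        (fun k : Fin K => (oms.getD k 0 : ℝ) / 2 ^ 60 * ((js.getD k 0 : ℝ) / 500) ^ 2) ((WJ : ℝ) / 2 ^ 60) i j| ≤
      (pairAbs (WB * (K - 1)) (G1 + (packNodeB E1 oms dra ua).xa) (G2 + (packNodeB E1 oms dra ua).ya)
        (packNodeB E1 oms dra ua) (packNodeB E1 oms drb ub) uab : ℝ) := by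
  subst hG1 hG2 hPOS
  obtain ⟨da, ra⟩ := dra
  obtain ⟨db, rb⟩ := drb
  have hUj : ∀ k, k < js.length → Uk Wmax 500 (js.getD k 0) ≤ 1 / 26 := fun k hk => hU k (by omega)
  have hraS : RowSmall ra := rowSmall_of_rowOK hra hUj
  have hrbS : RowSmall rb := rowSmall_of_rowOK hrb hUj
  have hda1 : 1 ≤ da := hra.1
  have hda : da ≤ 8 := hra.2.1
  have hdb1 : 1 ≤ db := hrb.1
  have hdb : db ≤ 8 := hrb.2.1
  have hla' : ra.length = K := hra.2.2.1.trans hKjs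
  have hlb' : rb.length = K := hrb.2.2.1.trans hKjs
  -- error hypotheses
  have hea : ∀ k, k < K → ‖zhat ra k - ztrue js k (Real.log (((i : ℕ) + 2 : ℕ) : ℝ))‖ ≤
      (2 * da - 1 : ℝ) * Uk Wmax 500 (js.getD k 0) :=
    fun k hk => zhat_err_of_rowOK hra k (by omega)
  have heb : ∀ k, k < K → ‖zhat rb k - ztrue js k (Real.log (((j : ℕ) + 2 : ℕ) : ℝ))‖ ≤
      (2 * db - 1 : ℝ) * Uk Wmax 500 (js.getD k 0) :=
    fun k hk => zhat_err_of_rowOK hrb k (by omega)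
  -- the real bracket
  obtain ⟨hlo, hhi⟩ := pair_bracket (CL := CL) (CH := CH) (E1 := E1) hea heb hU hda hdb hda1 hdb1 hE hCL hCH
    hua1 hua2 hub1 hub2 huab1 huab2 (screw_offdiag i j hij)
  -- sizes
  have hZ172 : 2 ^ 172 ≤ ZB := by unfold ZB; exact Nat.pow_le_pow_right (by norm_num) (by norm_num)
  have hZ173 : 2 ^ 173 ≤ ZB := by unfold ZB; exact Nat.pow_le_pow_right (by norm_num) (by norm_num)
  have hF4 : 4 * da * E1 ≤ 2 ^ 172 :=
    calc 4 * da * E1 ≤ 4 * 8 * 2 ^ 167 := Nat.mul_le_mul (Nat.mul_le_mul_left _ hda) hE1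
      _ = 2 ^ 172 := by norm_num
  have hF45 : (4 * db + 5) * E1 ≤ 2 ^ 173 :=
    calc (4 * db + 5) * E1 ≤ (4 * 8 + 5) * 2 ^ 167 :=
        Nat.mul_le_mul (Nat.add_le_add_right (Nat.mul_le_mul_left _ hdb) _) hE1
      _ ≤ 2 ^ 173 := by norm_num
  have huab3' : uab.1 < 2 ^ 174 := by
    have h1 : ((uab.1 : ℕ) : ℝ) ≤ uab.2 := huab1.trans huab2
    have h2 : uab.1 ≤ uab.2 := by exact_mod_cast h1
    exact lt_of_le_of_lt h2 huab3
  -- integer fields and the numerator identity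
  have hxa := xa_cast E1 da oms ra ua (hF4.trans hZ172)
  have hxb := xb_cast E1 db oms rb ub (hF45.trans hZ173)
  have hya := ya_cast E1 da oms ra ua
  have hyb := yb_cast E1 db oms rb ub
  have hnum0 := pair_num hK1 hK2 ho hraS hrbS hKoms hla' hlb' E1 da db WJ ua ub
  have hnum : ((kdotS (WB * (K - 1)) (packNodeB E1 oms (da, ra) ua).uc (packNodeB E1 oms (db, rb) ub).vc : ℕ) : ℤ) +
      (kdotS (WB * (K - 1)) (packNodeB E1 oms (da, ra) ua).us (packNodeB E1 oms (db, rb) ub).vs : ℕ) +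
      ((2 ^ 104 * (sumN oms + WJ) + 2 * K * (D0 * D1) + 2 ^ 53 * K * D0 : ℕ) : ℤ) -
      (((D1 * ((packNodeB E1 oms (da, ra) ua).lwc + (packNodeB E1 oms (da, ra) ua).lws) +
          SCL * (packNodeB E1 oms (da, ra) ua).lwc : ℕ) : ℤ) +
        ((D0 * ((packNodeB E1 oms (db, rb) ub).mpc + (packNodeB E1 oms (db, rb) ub).mps) +
          SCL * (packNodeB E1 oms (db, rb) ub).lwc : ℕ) : ℤ)) = Num oms ra rb K WJ := by
    rw [← hnum0]
    push_cast
    ring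
  rw [remainder_entry hpos]
  exact pairAbs_ge hxa hxb hya hyb hnum (pos_le hKoms ho hK2 hWJ) hF4 hF45 huab3' huab3 hlo hhi

/-- **Per node** `a = i+2`: `diagLoN ≤ 2^164 R_ii + 2·OZ + ZB` for the packed node of the correct row of `a` (when the
diagonal bound is not truncated). -/
theorem diag_ge {n K E1 Wmax WJ CL WJS2 : ℕ} {js oms : List ℕ} {dra : ℕ × List (ℕ × ℕ)} {ua : ℕ × ℕ} (i : Fin n)
    (hKjs : js.length = K) (hKoms : oms.length = K) (ho : OmSmall oms)
    (hpos : ∀ k, k < K → 0 < js.getD k 0) (hU : ∀ k, k < K → Uk Wmax 500 (js.getD k 0) ≤ 1 / 26)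
    (hra : RowOK Wmax 500 js ((i : ℕ) + 2) dra)
    (hE : 2 ^ 104 * ∑ k ∈ range K, (oms.getD k 0 : ℝ) * Uk Wmax 500 (js.getD k 0) ≤ E1)
    (hCL : (CL : ℝ) ≤ 2 ^ 162 * RungCert.lerchC)
    (hua1 : (ua.1 : ℝ) ≤ 2 ^ 164 * RungCert.uR ((i : ℕ) + 2) 1 + OZ)
    (hWJS2 : WJS2 = 2 ^ 104 * (2 * sumN oms + WJ) + 2 ^ 53 * K * D0)
    (hD : 0 < diagLoN CL WJS2 E1 (packNodeB E1 oms dra ua)) :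
    ((diagLoN CL WJS2 E1 (packNodeB E1 oms dra ua) : ℕ) : ℝ) ≤
      2 ^ 164 * remainder n K (fun k : Fin K => (js.getD k 0 : ℝ) / 500)
        (fun k : Fin K => (oms.getD k 0 : ℝ) / 2 ^ 60 * ((js.getD k 0 : ℝ) / 500) ^ 2) ((WJ : ℝ) / 2 ^ 60) i i +
        2 * OZ + ZB := by
  obtain ⟨da, ra⟩ := dra
  have hUj : ∀ k, k < js.length → Uk Wmax 500 (js.getD k 0) ≤ 1 / 26 := fun k hk => hU k (by omega)
  have hraS : RowSmall ra := rowSmall_of_rowOK hra hUj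
  have hda1 : 1 ≤ da := hra.1
  have hla' : ra.length = K := hra.2.2.1.trans hKjs
  have hea : ∀ k, k < K → ‖zhat ra k - ztrue js k (Real.log (((i : ℕ) + 2 : ℕ) : ℝ))‖ ≤
      (2 * da - 1 : ℝ) * Uk Wmax 500 (js.getD k 0) :=
    fun k hk => zhat_err_of_rowOK hra k (by omega)
  have herr := numD_err (oms := oms) (WJ := WJ) hea
  have hlwc := lwc_cast (E1 := E1) (da := da) ua ho hraS hKoms hla'
  have hW : ((WJS2 : ℕ) : ℤ) = 2 ^ 104 * (2 * So oms K + WJ) + 2 ^ 53 * K * D0 := by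
    rw [hWJS2]; push_cast; rw [sumN_oms hKoms]
  rw [remainder_entry hpos, PR_diag]
  exact diagLoN_le hD rfl hlwc hW hua1 hCL herr hE hda1 (screw_diag i)

end Summit.RiemannHypothesis.RiemannHypothesis.Theorems.IntegerScrew.Manifest.Fast
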